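import Mathlib
import Summits.NavierStokesRegularity.NavierStokesRegularity.Theorems.AxisTwistDoorAveragedConeLiouvilleNUDefs
import Literature.Analysis.FluidPDE.SereginSverakBlowupSelection
import HarnessLib

/-!
# Route `AxisTwistDoor`, crux `AveragedConeLiouville` (stmt-NavierStokesRegularity-26889) — INPUT N4, piece P5 (part 1):
# THE TWO STEPS OF NAZAROV–URAL'TSEVA'S CHAIN, axis-free (Cor 3.2 (1) and Cor 3.2 (2) from the three atoms)

N4 cut of record (pub/ns-inputs STATUS 2026-08-28T11:29:42Z; texts `kits/N4-skeleton.lean` 5372b51f971b2f9d; definitions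
`…AxisTwistDoorAveragedConeLiouvilleNUDefs`, p629795).  Piece P5 = `stub_factC_of_atoms : Sig.nu_smallSublevel_lowerBound →
Sig.nu_densityPropagation → Sig.nu_shrinking → Sig.nu_standing_of_classical → PositivityPropagationFactC`; this file holds its two
De Giorgi steps, with the three analytic atoms as HYPOTHESES ALREADY SPECIALISED to the data `Φ` of one frame (scale `R`, level cap
`k`) and to fixed constants — the axis-free twins of the A1 programme's `chain_step` (crux `AxisymmetricKatoGlobal`,
`…Lemma22ExpansionStep`), re-cut for balls LARGER than the frame scale (the shrinking atom is used with a ratio `λ₃ ∈ [λlo₃, 2]`,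
`λ₃ r ≤ 2R`, instead of `λ = 2`), which the closed-cylinder target `PositivityPropagationFactC` needs (conclusion on `B(0,r)`, any
`r < 1`):

* `nu_first_step` — **Cor 3.2 (1)**: density `δ₀` of `{Φ ≥ κ}` in `B(r)` at the bottom slice ⇒ `Φ ≥ 2^{-(s+1)}δ₀κ/3` a.e. on the
  UPPER HALF window `]t_b + θr²/2, t_b + θr²[ × B(r')` (L3.2′(δ₀) ⇒ L3.3′(δ₁ = δ₀/3) ⇒ L3.1′ (i));
* `nu_chain_step` — **Cor 3.2 (2)**: `Φ ≥ κ` on `B(r)` at the bottom slice ⇒ `Φ ≥ 2^{-(s+1)}κ/3` a.e. on the WHOLE window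
  `]t_b, t_b + θr²[ × B(r')` (L3.2′(1) ⇒ L3.3′(1/3) ⇒ L3.1′ (ii));
* `forall_le_of_ae_cylinder_le` — «a.e. on an open cylinder below `t = 0` ⇒ everywhere on it» for `Φ` continuous on `{t < 0}`
  (the `NUStanding` continuity clause); `le_on_Icc_of_le_on_Ioo`, `continuousAt_timeLine` — passage to the closed time interval for
  the classical `V`; `annulus_density_le` — `|{V(t̄) ≥ λ} ∩ B₁| ≥ δ ⇒ δ₀|B(R₀)| ≤ |{V(t̄) ≥ λ} ∩ B(R₀)|` (density in a slightly
  smaller ball, `|B₁ ∖ B(R₀)| ≤ 3|B₁|(1 − R₀)`).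

Parameter schedule (n1) and feasibility (n2) of the cut are in part 2 (`…NUFactCOfAtoms`), which assembles `PositivityPropagationFactC`.
WHAT THIS IS NOT: no NS-regularity statement is touched; N4 is an INPUT (Nazarov–Ural'tseva 2011 §3 re-proved in the kernel); item
26889 and the summit stay OPEN.  `--supports stmt-NavierStokesRegularity-26889 --as helper`.
[cite: NazarovUraltseva2011HarnackDivFree, §3 Cor 3.2 (1)(2) (arXiv:1011.1888 pp. 9–10)] [cite: LeiRenTian2025, Lemma 2.5]
-/

noncomputable section

-- the summit and its single sub-problem share the name (CONVENTIONS §1)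
set_option linter.dupNamespace false

open MeasureTheory Set Function Metric Filter Topology
open scoped NNReal ENNReal

namespace Summit.NavierStokesRegularity.NavierStokesRegularity.Theorems.AveragedConeLiouville.NUPositivity

open Literature.Analysis.FluidPDE

/-! ### Continuity tools -/

/-- **«a.e. on an open cylinder below `t = 0` ⇒ everywhere on it»** for `Φ` continuous on the half-space `{t < 0}` (the
`NUStanding` continuity clause; `SereginSverak2009.forall_le_of_ae_le_of_continuousOn`). [folklore] -/
theorem forall_le_of_ae_cylinder_le {Φ : ℝ → EuclideanSpace ℝ (Fin 3) → ℝ}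
    (hcont : ContinuousOn (uncurry Φ) {z : ℝ × EuclideanSpace ℝ (Fin 3) | z.1 < 0})
    {a b ρ c : ℝ} (hb : b ≤ 0)
    (h : ∀ᵐ z ∂(volume.restrict (Ioo a b ×ˢ ball (0 : EuclideanSpace ℝ (Fin 3)) ρ)), c ≤ Φ z.1 z.2) :
    ∀ s ∈ Ioo a b, ∀ x ∈ ball (0 : EuclideanSpace ℝ (Fin 3)) ρ, c ≤ Φ s x := by
  have hWo : IsOpen (Ioo a b ×ˢ ball (0 : EuclideanSpace ℝ (Fin 3)) ρ) := isOpen_Ioo.prod isOpen_ball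
  have hsub : Ioo a b ×ˢ ball (0 : EuclideanSpace ℝ (Fin 3)) ρ ⊆ {z : ℝ × EuclideanSpace ℝ (Fin 3) | z.1 < 0} :=
    fun z hz => lt_of_lt_of_le hz.1.2 hb
  have h' : ∀ᵐ z ∂(volume.restrict (Ioo a b ×ˢ ball (0 : EuclideanSpace ℝ (Fin 3)) ρ)),
      (fun _ => c) z ≤ uncurry Φ z := h
  have hall := SereginSverak2009.forall_le_of_ae_le_of_continuousOn hWo continuousOn_const (hcont.mono hsub) h'
  intro s hs x hx
  exact hall (s, x) ⟨hs, hx⟩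

/-- Time lines of a jointly continuous function are continuous (at points of an open set of continuity). [folklore] -/
theorem continuousAt_timeLine {V : ℝ → EuclideanSpace ℝ (Fin 3) → ℝ} {U : Set (ℝ × EuclideanSpace ℝ (Fin 3))}
    (hU : IsOpen U) (hV : ContinuousOn (uncurry V) U) {t : ℝ} {x : EuclideanSpace ℝ (Fin 3)} (hz : (t, x) ∈ U) :
    ContinuousAt (fun s => V s x) t := by
  have h1 : ContinuousAt (uncurry V) (t, x) := hV.continuousAt (hU.mem_nhds hz)
  have h2 : ContinuousAt (fun s : ℝ => ((s, x) : ℝ × EuclideanSpace ℝ (Fin 3))) t :=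
    (continuous_id.prodMk continuous_const).continuousAt
  have h3 : ContinuousAt (uncurry V ∘ fun s : ℝ => ((s, x) : ℝ × EuclideanSpace ℝ (Fin 3))) t :=
    ContinuousAt.comp (f := fun s : ℝ => ((s, x) : ℝ × EuclideanSpace ℝ (Fin 3))) h1 h2
  exact h3

/-- **From the open to the closed time interval** along a time line continuous at every point of `[a, b]` (`a < b`). [folklore] -/
theorem le_on_Icc_of_le_on_Ioo {V : ℝ → EuclideanSpace ℝ (Fin 3) → ℝ} {a b c : ℝ} {x : EuclideanSpace ℝ (Fin 3)}
    (hab : a < b) (hVc : ∀ t ∈ Icc a b, ContinuousAt (fun s => V s x) t)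
    (h : ∀ s ∈ Ioo a b, c ≤ V s x) : ∀ t ∈ Icc a b, c ≤ V t x := by
  intro t ht
  have hmem : t ∈ closure (Ioo a b) := by rw [closure_Ioo hab.ne]; exact ht
  haveI : (𝓝[Ioo a b] t).NeBot := mem_closure_iff_nhdsWithin_neBot.1 hmem
  have hlim : Tendsto (fun s => V s x) (𝓝[Ioo a b] t) (𝓝 (V t x)) :=
    (hVc t ht).tendsto.mono_left nhdsWithin_le_nhds
  exact ge_of_tendsto hlim (eventually_nhdsWithin_of_forall fun s hs => h s hs)

/-! ### The two steps of the chain -/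

variable {Φ : ℝ → EuclideanSpace ℝ (Fin 3) → ℝ} {k R θ₀ μ μ₁ lamlo lamlo₃ θlo θhi δ₀ : ℝ} {s : ℕ}

/-- **N–U Cor 3.2 (1), axis-free, from the three atoms** (specialised to the data at scale `R`, level cap `k`, constants fixed:
`h32` = L3.2′ with density `δ₀`, window constant `θ₀`; `h33` = L3.3′ with `δ₁ = δ₀/3`, ratios `λ ∈ [λlo₃, 2]`, fraction `μ`, exponent
`s`, windows `[θlo, θhi]`; `h31` = L3.1′ with fraction `μ₁ ≥ μ`, ratios `[λlo, 2]`, windows `[θlo, θhi]`).  STEP: radii `r' < r`,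
`r/r' ∈ [λlo, 2]`, `R/4 ≤ r'`, a room ratio `λ₃ ∈ [λlo₃, 2]`, `λ₃ ≥ 1`, `λ₃ r ≤ 2R`; a window `θr²` with `θ, 4θ ∈ [θlo, θhi]`, `θ ≤ θ₀`;
bottom `t_b > -R²`, top `t_b + θr² ≤ 0`; a level `0 < κ ≤ k`.  If `|{Φ(t_b,·) ≥ κ} ∩ B(r)| ≥ δ₀|B(r)|`, then
`Φ ≥ 2^{-(s+1)}δ₀κ/3` a.e. on `]t_b + θr²/2, t_b + θr²[ × B(r')`: density `δ₀` at `t_b` ⇒ density `δ₀/3` of `{Φ ≥ δ₀κ/3}` on the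
window (L3.2′) ⇒ `{Φ < 2^{-s}δ₀κ/3}` has fraction `≤ μ ≤ μ₁` of `]t_b, t_b+θr²[ × B(r)` (L3.3′ on the same ball, room `λ₃ r ≤ 2R`) ⇒
L3.1′ (i) with outer radius `r = (r/r')·r'` gives the claim on the upper half window.
[cite: NazarovUraltseva2011HarnackDivFree, §3 Cor 3.2 (1) (arXiv p. 10)] -/
theorem nu_first_step
    (h32 : ∀ (ρ θ t₀ κ : ℝ), R / 4 ≤ ρ → ρ ≤ 2 * R → 0 < θ → θ ≤ θ₀ →
      t₀ ≤ 0 → -R ^ 2 < t₀ - θ * ρ ^ 2 → 0 < κ → κ ≤ k →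
      ENNReal.ofReal δ₀ * volume (ball (0 : EuclideanSpace ℝ (Fin 3)) ρ)
        ≤ volume {x : EuclideanSpace ℝ (Fin 3) |
            x ∈ ball (0 : EuclideanSpace ℝ (Fin 3)) ρ ∧ κ ≤ Φ (t₀ - θ * ρ ^ 2) x} →
      ∀ t ∈ Icc (t₀ - θ * ρ ^ 2) t₀, t < 0 →
        ENNReal.ofReal (δ₀ / 3) * volume (ball (0 : EuclideanSpace ℝ (Fin 3)) ρ)
          ≤ volume {x : EuclideanSpace ℝ (Fin 3) |
              x ∈ ball (0 : EuclideanSpace ℝ (Fin 3)) ρ ∧ δ₀ * κ / 3 ≤ Φ t x})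
    (h33 : ∀ (lam ρ θ t₀ κ₀ : ℝ), lamlo₃ ≤ lam → lam ≤ 2 → R / 4 ≤ ρ → lam * ρ ≤ 2 * R →
      θlo ≤ θ → θ ≤ θhi → t₀ ≤ 0 → -R ^ 2 < t₀ - θ * ρ ^ 2 → 0 < κ₀ → κ₀ ≤ k →
      (∀ᵐ t ∂(volume.restrict (Ioo (t₀ - θ * ρ ^ 2) t₀)),
        ENNReal.ofReal (δ₀ / 3) * volume (ball (0 : EuclideanSpace ℝ (Fin 3)) ρ)
          ≤ volume {x : EuclideanSpace ℝ (Fin 3) |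
              x ∈ ball (0 : EuclideanSpace ℝ (Fin 3)) ρ ∧ κ₀ ≤ Φ t x}) →
      volume {z : ℝ × EuclideanSpace ℝ (Fin 3) |
          z ∈ Ioo (t₀ - θ * ρ ^ 2) t₀ ×ˢ ball (0 : EuclideanSpace ℝ (Fin 3)) ρ ∧
            Φ z.1 z.2 < (2 : ℝ)⁻¹ ^ s * κ₀}
        ≤ ENNReal.ofReal μ *
          volume (Ioo (t₀ - θ * ρ ^ 2) t₀ ×ˢ ball (0 : EuclideanSpace ℝ (Fin 3)) ρ))
    (h31 : ∀ (lam ρ θ t₀ l : ℝ), lamlo ≤ lam → lam ≤ 2 → R / 4 ≤ ρ → lam * ρ ≤ 2 * R →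
      θlo ≤ θ → θ ≤ θhi → t₀ ≤ 0 → -R ^ 2 < t₀ - θ * ρ ^ 2 → 0 < l → l ≤ k →
      volume {z : ℝ × EuclideanSpace ℝ (Fin 3) |
          z ∈ Ioo (t₀ - θ * ρ ^ 2) t₀ ×ˢ ball (0 : EuclideanSpace ℝ (Fin 3)) (lam * ρ) ∧
            Φ z.1 z.2 < l}
        ≤ ENNReal.ofReal μ₁ *
          volume (Ioo (t₀ - θ * ρ ^ 2) t₀ ×ˢ ball (0 : EuclideanSpace ℝ (Fin 3)) (lam * ρ)) →
      (∀ᵐ z ∂(volume.restrict (Ioo (t₀ - θ / 2 * ρ ^ 2) t₀ ×ˢ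
          ball (0 : EuclideanSpace ℝ (Fin 3)) ρ)), l / 2 ≤ Φ z.1 z.2) ∧
      ((∀ᵐ x ∂(volume.restrict (ball (0 : EuclideanSpace ℝ (Fin 3)) (lam * ρ))),
          l ≤ Φ (t₀ - θ * ρ ^ 2) x) →
        ∀ᵐ z ∂(volume.restrict (Ioo (t₀ - θ * ρ ^ 2) t₀ ×ˢ
          ball (0 : EuclideanSpace ℝ (Fin 3)) ρ)), l / 2 ≤ Φ z.1 z.2))
    (hμ : μ ≤ μ₁) (hδ₀ : 0 < δ₀) (hδ₀1 : δ₀ ≤ 1)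
    {r r' θ tb κ lam₃ : ℝ} (hRr' : R / 4 ≤ r') (hr'0 : 0 < r') (hrr' : r' < r)
    (hl₃ : lamlo₃ ≤ lam₃) (hl₃2 : lam₃ ≤ 2) (hl₃1 : 1 ≤ lam₃) (hroom : lam₃ * r ≤ 2 * R)
    (hlam : lamlo ≤ r / r') (hlam2 : r / r' ≤ 2)
    (hθlo : θlo ≤ θ) (hθ0 : 0 < θ) (hθθ₀ : θ ≤ θ₀) (hθhi : 4 * θ ≤ θhi)
    (htb : -R ^ 2 < tb) (htop : tb + θ * r ^ 2 ≤ 0) (hκ : 0 < κ) (hκk : κ ≤ k)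
    (hdens : ENNReal.ofReal δ₀ * volume (ball (0 : EuclideanSpace ℝ (Fin 3)) r)
      ≤ volume {x : EuclideanSpace ℝ (Fin 3) | x ∈ ball (0 : EuclideanSpace ℝ (Fin 3)) r ∧ κ ≤ Φ tb x}) :
    ∀ᵐ z ∂(volume.restrict (Ioo (tb + θ * r ^ 2 / 2) (tb + θ * r ^ 2) ×ˢ ball (0 : EuclideanSpace ℝ (Fin 3)) r')),
      (2 : ℝ)⁻¹ ^ (s + 1) * δ₀ / 3 * κ ≤ Φ z.1 z.2 := by
  -- adapted from …AxisymmetricKatoGlobalStubSeregin2020TypeIILemma22ExpansionStep (`chain_step`) / …ExpansionOfPositivityV2 (Step 1)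
  set t₀ : ℝ := tb + θ * r ^ 2 with ht₀
  have e0 : t₀ - θ * r ^ 2 = tb := by rw [ht₀]; ring
  have hr0 : 0 < r := hr'0.trans hrr'
  have hRr : R / 4 ≤ r := hRr'.trans hrr'.le
  have hr2R : r ≤ 2 * R := le_trans (by nlinarith) hroom
  -- (1) L3.2′ with density `δ₀`: density `δ₀/3` of `{Φ ≥ δ₀κ/3}` in `B(r)` on the whole window
  have h1 : ∀ t ∈ Icc tb t₀, t < 0 →
      ENNReal.ofReal (δ₀ / 3) * volume (ball (0 : EuclideanSpace ℝ (Fin 3)) r)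
        ≤ volume {x : EuclideanSpace ℝ (Fin 3) |
            x ∈ ball (0 : EuclideanSpace ℝ (Fin 3)) r ∧ δ₀ * κ / 3 ≤ Φ t x} := by
    have h := h32 r θ t₀ κ hRr hr2R hθ0 hθθ₀ htop (by rw [e0]; exact htb) hκ hκk (by rw [e0]; exact hdens)
    rw [e0] at h
    exact h
  -- (2) L3.3′ with `δ₁ = δ₀/3`, `κ₀ = δ₀κ/3`, on the same ball (room `λ₃ r ≤ 2R`)
  have hκ₀ : 0 < δ₀ * κ / 3 := by positivity
  have hκ₀k : δ₀ * κ / 3 ≤ k := by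
    have : δ₀ * κ ≤ 1 * κ := mul_le_mul_of_nonneg_right hδ₀1 hκ.le
    linarith
  have h2 : volume {z : ℝ × EuclideanSpace ℝ (Fin 3) |
      z ∈ Ioo tb t₀ ×ˢ ball (0 : EuclideanSpace ℝ (Fin 3)) r ∧ Φ z.1 z.2 < (2 : ℝ)⁻¹ ^ s * (δ₀ * κ / 3)}
        ≤ ENNReal.ofReal μ * volume (Ioo tb t₀ ×ˢ ball (0 : EuclideanSpace ℝ (Fin 3)) r) := by
    have h := h33 lam₃ r θ t₀ (δ₀ * κ / 3) hl₃ hl₃2 hRr hroom hθlo (by linarith) htop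
      (by rw [e0]; exact htb) hκ₀ hκ₀k
    rw [e0] at h
    refine h ?_
    rw [ae_restrict_iff' measurableSet_Ioo]
    exact ae_of_all _ fun t ht => h1 t ⟨ht.1.le, ht.2.le⟩ (lt_of_lt_of_le ht.2 htop)
  -- (3) L3.1′ (i) on the cylinder of inner radius `r'`, outer radius `r = (r/r') r'`
  have e1 : r / r' * r' = r := div_mul_cancel₀ r hr'0.ne'
  have e2 : t₀ - θ * (r / r') ^ 2 * r' ^ 2 = tb := by
    rw [← e0, div_pow]
    field_simp
  have e3 : t₀ - θ * (r / r') ^ 2 / 2 * r' ^ 2 = tb + θ * r ^ 2 / 2 := by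
    rw [ht₀, div_pow]
    field_simp
    ring
  have hl0 : 0 < (2 : ℝ)⁻¹ ^ s * (δ₀ * κ / 3) := by positivity
  have hl1 : (2 : ℝ)⁻¹ ^ s * (δ₀ * κ / 3) ≤ k := by
    have hp : (2 : ℝ)⁻¹ ^ s ≤ 1 := pow_le_one₀ (by norm_num) (by norm_num)
    have : (2 : ℝ)⁻¹ ^ s * (δ₀ * κ / 3) ≤ 1 * (δ₀ * κ / 3) := mul_le_mul_of_nonneg_right hp hκ₀.le
    linarith
  have hθ' : θlo ≤ θ * (r / r') ^ 2 ∧ θ * (r / r') ^ 2 ≤ θhi := by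
    have hge : 1 ≤ (r / r') ^ 2 := by
      have : 1 ≤ r / r' := by rw [le_div_iff₀ hr'0]; linarith
      nlinarith
    have hle : (r / r') ^ 2 ≤ 4 := by nlinarith [div_pos hr0 hr'0]
    constructor <;> nlinarith
  have h := h31 (r / r') r' (θ * (r / r') ^ 2) t₀ ((2 : ℝ)⁻¹ ^ s * (δ₀ * κ / 3)) hlam hlam2 hRr'
  rw [e1, e2, e3] at h
  have h3 := (h (by linarith) hθ'.1 hθ'.2 htop htb hl0 hl1 (h2.trans (by gcongr))).1
  filter_upwards [h3] with z hz
  calc (2 : ℝ)⁻¹ ^ (s + 1) * δ₀ / 3 * κ = (2 : ℝ)⁻¹ ^ s * (δ₀ * κ / 3) / 2 := by ring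
    _ ≤ Φ z.1 z.2 := hz

/-- **N–U Cor 3.2 (2), axis-free, from the three atoms** (`h32` = L3.2′ with density `1`; `h33` = L3.3′ with `δ₁ = 1/3`, ratios
`[λlo₃, 2]`; `h31` = L3.1′, ratios `[λlo, 2]`; geometry as in `nu_first_step`).  If `Φ(t_b, ·) ≥ κ` on `B(r)`, then
`Φ ≥ 2^{-(s+1)}κ/3` a.e. on `]t_b, t_b + θr²[ × B(r')`: density `1` at `t_b` ⇒ density `1/3` of `{Φ ≥ κ/3}` on the window (L3.2′) ⇒
`{Φ < 2^{-s}κ/3}` has fraction `≤ μ ≤ μ₁` of `]t_b, t_b+θr²[ × B(r)` (L3.3′) ⇒ with the bottom bound `Φ(t_b,·) ≥ κ ≥ 2^{-s}κ/3` on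
`B(r)`, L3.1′ (ii) gives the claim on the whole window.  (Axis-free twin of the A1 `chain_step`, with the room ratio `λ₃`.)
[cite: NazarovUraltseva2011HarnackDivFree, §3 Cor 3.2 (2) (arXiv p. 10)] -/
theorem nu_chain_step
    (h32 : ∀ (ρ θ t₀ κ : ℝ), R / 4 ≤ ρ → ρ ≤ 2 * R → 0 < θ → θ ≤ θ₀ →
      t₀ ≤ 0 → -R ^ 2 < t₀ - θ * ρ ^ 2 → 0 < κ → κ ≤ k →
      ENNReal.ofReal 1 * volume (ball (0 : EuclideanSpace ℝ (Fin 3)) ρ)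
        ≤ volume {x : EuclideanSpace ℝ (Fin 3) |
            x ∈ ball (0 : EuclideanSpace ℝ (Fin 3)) ρ ∧ κ ≤ Φ (t₀ - θ * ρ ^ 2) x} →
      ∀ t ∈ Icc (t₀ - θ * ρ ^ 2) t₀, t < 0 →
        ENNReal.ofReal (1 / 3) * volume (ball (0 : EuclideanSpace ℝ (Fin 3)) ρ)
          ≤ volume {x : EuclideanSpace ℝ (Fin 3) |
              x ∈ ball (0 : EuclideanSpace ℝ (Fin 3)) ρ ∧ 1 * κ / 3 ≤ Φ t x})
    (h33 : ∀ (lam ρ θ t₀ κ₀ : ℝ), lamlo₃ ≤ lam → lam ≤ 2 → R / 4 ≤ ρ → lam * ρ ≤ 2 * R →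
      θlo ≤ θ → θ ≤ θhi → t₀ ≤ 0 → -R ^ 2 < t₀ - θ * ρ ^ 2 → 0 < κ₀ → κ₀ ≤ k →
      (∀ᵐ t ∂(volume.restrict (Ioo (t₀ - θ * ρ ^ 2) t₀)),
        ENNReal.ofReal (1 / 3) * volume (ball (0 : EuclideanSpace ℝ (Fin 3)) ρ)
          ≤ volume {x : EuclideanSpace ℝ (Fin 3) |
              x ∈ ball (0 : EuclideanSpace ℝ (Fin 3)) ρ ∧ κ₀ ≤ Φ t x}) →
      volume {z : ℝ × EuclideanSpace ℝ (Fin 3) |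
          z ∈ Ioo (t₀ - θ * ρ ^ 2) t₀ ×ˢ ball (0 : EuclideanSpace ℝ (Fin 3)) ρ ∧
            Φ z.1 z.2 < (2 : ℝ)⁻¹ ^ s * κ₀}
        ≤ ENNReal.ofReal μ *
          volume (Ioo (t₀ - θ * ρ ^ 2) t₀ ×ˢ ball (0 : EuclideanSpace ℝ (Fin 3)) ρ))
    (h31 : ∀ (lam ρ θ t₀ l : ℝ), lamlo ≤ lam → lam ≤ 2 → R / 4 ≤ ρ → lam * ρ ≤ 2 * R →
      θlo ≤ θ → θ ≤ θhi → t₀ ≤ 0 → -R ^ 2 < t₀ - θ * ρ ^ 2 → 0 < l → l ≤ k →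
      volume {z : ℝ × EuclideanSpace ℝ (Fin 3) |
          z ∈ Ioo (t₀ - θ * ρ ^ 2) t₀ ×ˢ ball (0 : EuclideanSpace ℝ (Fin 3)) (lam * ρ) ∧
            Φ z.1 z.2 < l}
        ≤ ENNReal.ofReal μ₁ *
          volume (Ioo (t₀ - θ * ρ ^ 2) t₀ ×ˢ ball (0 : EuclideanSpace ℝ (Fin 3)) (lam * ρ)) →
      (∀ᵐ z ∂(volume.restrict (Ioo (t₀ - θ / 2 * ρ ^ 2) t₀ ×ˢ
          ball (0 : EuclideanSpace ℝ (Fin 3)) ρ)), l / 2 ≤ Φ z.1 z.2) ∧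
      ((∀ᵐ x ∂(volume.restrict (ball (0 : EuclideanSpace ℝ (Fin 3)) (lam * ρ))),
          l ≤ Φ (t₀ - θ * ρ ^ 2) x) →
        ∀ᵐ z ∂(volume.restrict (Ioo (t₀ - θ * ρ ^ 2) t₀ ×ˢ
          ball (0 : EuclideanSpace ℝ (Fin 3)) ρ)), l / 2 ≤ Φ z.1 z.2))
    (hμ : μ ≤ μ₁)
    {r r' θ tb κ lam₃ : ℝ} (hRr' : R / 4 ≤ r') (hr'0 : 0 < r') (hrr' : r' < r)
    (hl₃ : lamlo₃ ≤ lam₃) (hl₃2 : lam₃ ≤ 2) (hl₃1 : 1 ≤ lam₃) (hroom : lam₃ * r ≤ 2 * R)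
    (hlam : lamlo ≤ r / r') (hlam2 : r / r' ≤ 2)
    (hθlo : θlo ≤ θ) (hθ0 : 0 < θ) (hθθ₀ : θ ≤ θ₀) (hθhi : 4 * θ ≤ θhi)
    (htb : -R ^ 2 < tb) (htop : tb + θ * r ^ 2 ≤ 0) (hκ : 0 < κ) (hκk : κ ≤ k)
    (hslice : ∀ x ∈ ball (0 : EuclideanSpace ℝ (Fin 3)) r, κ ≤ Φ tb x) :
    ∀ᵐ z ∂(volume.restrict (Ioo tb (tb + θ * r ^ 2) ×ˢ ball (0 : EuclideanSpace ℝ (Fin 3)) r')),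
      (2 : ℝ)⁻¹ ^ (s + 1) / 3 * κ ≤ Φ z.1 z.2 := by
  -- adapted from …AxisymmetricKatoGlobalStubSeregin2020TypeIILemma22ExpansionStep (`chain_step`)
  set t₀ : ℝ := tb + θ * r ^ 2 with ht₀
  have e0 : t₀ - θ * r ^ 2 = tb := by rw [ht₀]; ring
  have hr0 : 0 < r := hr'0.trans hrr'
  have hRr : R / 4 ≤ r := hRr'.trans hrr'.le
  have hr2R : r ≤ 2 * R := le_trans (by nlinarith) hroom
  -- (1) L3.2′ with density `1`
  have hdens : ENNReal.ofReal 1 * volume (ball (0 : EuclideanSpace ℝ (Fin 3)) r)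
      ≤ volume {x : EuclideanSpace ℝ (Fin 3) | x ∈ ball (0 : EuclideanSpace ℝ (Fin 3)) r ∧ κ ≤ Φ tb x} := by
    rw [ENNReal.ofReal_one, one_mul]
    exact measure_mono fun x hx => ⟨hx, hslice x hx⟩
  have h1 : ∀ t ∈ Icc tb t₀, t < 0 →
      ENNReal.ofReal (1 / 3) * volume (ball (0 : EuclideanSpace ℝ (Fin 3)) r)
        ≤ volume {x : EuclideanSpace ℝ (Fin 3) |
            x ∈ ball (0 : EuclideanSpace ℝ (Fin 3)) r ∧ κ / 3 ≤ Φ t x} := by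
    have h := h32 r θ t₀ κ hRr hr2R hθ0 hθθ₀ htop (by rw [e0]; exact htb) hκ hκk (by rw [e0]; exact hdens)
    rw [e0] at h
    intro t ht ht0
    simpa only [one_mul] using h t ht ht0
  -- (2) L3.3′ with `δ₁ = 1/3`, `κ₀ = κ/3` (room `λ₃ r ≤ 2R`)
  have h2 : volume {z : ℝ × EuclideanSpace ℝ (Fin 3) |
      z ∈ Ioo tb t₀ ×ˢ ball (0 : EuclideanSpace ℝ (Fin 3)) r ∧ Φ z.1 z.2 < (2 : ℝ)⁻¹ ^ s * (κ / 3)}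
        ≤ ENNReal.ofReal μ * volume (Ioo tb t₀ ×ˢ ball (0 : EuclideanSpace ℝ (Fin 3)) r) := by
    have h := h33 lam₃ r θ t₀ (κ / 3) hl₃ hl₃2 hRr hroom hθlo (by linarith) htop
      (by rw [e0]; exact htb) (by positivity) (by linarith)
    rw [e0] at h
    refine h ?_
    rw [ae_restrict_iff' measurableSet_Ioo]
    exact ae_of_all _ fun t ht => h1 t ⟨ht.1.le, ht.2.le⟩ (lt_of_lt_of_le ht.2 htop)
  -- (3) L3.1′ (ii) on the cylinder of inner radius `r'`, outer radius `r = (r/r') r'`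
  have e1 : r / r' * r' = r := div_mul_cancel₀ r hr'0.ne'
  have e2 : t₀ - θ * (r / r') ^ 2 * r' ^ 2 = tb := by
    rw [← e0, div_pow]
    field_simp
  have hl0 : 0 < (2 : ℝ)⁻¹ ^ s * (κ / 3) := by positivity
  have hl1 : (2 : ℝ)⁻¹ ^ s * (κ / 3) ≤ κ := by
    have hp : (2 : ℝ)⁻¹ ^ s ≤ 1 := pow_le_one₀ (by norm_num) (by norm_num)
    nlinarith
  have hθ' : θlo ≤ θ * (r / r') ^ 2 ∧ θ * (r / r') ^ 2 ≤ θhi := by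
    have hge : 1 ≤ (r / r') ^ 2 := by
      have : 1 ≤ r / r' := by rw [le_div_iff₀ hr'0]; linarith
      nlinarith
    have hle : (r / r') ^ 2 ≤ 4 := by nlinarith [div_pos hr0 hr'0]
    constructor <;> nlinarith
  have h := h31 (r / r') r' (θ * (r / r') ^ 2) t₀ ((2 : ℝ)⁻¹ ^ s * (κ / 3)) hlam hlam2 hRr'
  rw [e1, e2] at h
  have h3 := (h (by linarith) hθ'.1 hθ'.2 htop htb hl0 (hl1.trans hκk)
    (h2.trans (by gcongr))).2
    ((ae_restrict_iff' measurableSet_ball).2 (ae_of_all _ fun x hx => hl1.trans (hslice x hx)))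
  filter_upwards [h3] with z hz
  calc (2 : ℝ)⁻¹ ^ (s + 1) / 3 * κ = (2 : ℝ)⁻¹ ^ s * (κ / 3) / 2 := by ring
    _ ≤ Φ z.1 z.2 := hz

/-! ### The annulus bound -/

/-- **Density in a slightly smaller ball.**  If `|{x ∈ B₁ : P x}| ≥ δ` and `3|B₁|(1 − R₀) ≤ δ/2` (`0 < R₀ ≤ 1`), then
`|{x ∈ B(R₀) : P x}| ≥ δ/2 ≥ δ₀|B(R₀)|` for `δ₀ ≤ δ/(2|B₁|)` (`|B₁ ∖ B(R₀)| = |B₁|(1 − R₀³) ≤ 3|B₁|(1−R₀)`). [folklore] -/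
theorem annulus_density_le {P : EuclideanSpace ℝ (Fin 3) → Prop} {δ δ₀ R₀ v : ℝ}
    (hv : volume (ball (0 : EuclideanSpace ℝ (Fin 3)) 1) = ENNReal.ofReal v) (hv0 : 0 < v)
    (hR₀0 : 0 < R₀) (hR₀1 : R₀ ≤ 1) (hR₀δ : 3 * v * (1 - R₀) ≤ δ / 2) (hδ₀0 : 0 ≤ δ₀) (hδ₀ : δ₀ * v ≤ δ / 2)
    (hmass : ENNReal.ofReal δ ≤ volume {x : EuclideanSpace ℝ (Fin 3) | x ∈ ball (0 : EuclideanSpace ℝ (Fin 3)) 1 ∧ P x}) :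
    ENNReal.ofReal δ₀ * volume (ball (0 : EuclideanSpace ℝ (Fin 3)) R₀) ≤
      volume {x : EuclideanSpace ℝ (Fin 3) | x ∈ ball (0 : EuclideanSpace ℝ (Fin 3)) R₀ ∧ P x} := by
  have hballR₀ : volume (ball (0 : EuclideanSpace ℝ (Fin 3)) R₀) = ENNReal.ofReal (R₀ ^ 3 * v) := by
    rw [Measure.addHaar_ball volume (0 : EuclideanSpace ℝ (Fin 3)) hR₀0.le, finrank_euclideanSpace, Fintype.card_fin, hv,
      ← ENNReal.ofReal_mul (by positivity)]
  have hsub : ball (0 : EuclideanSpace ℝ (Fin 3)) R₀ ⊆ ball (0 : EuclideanSpace ℝ (Fin 3)) 1 := ball_subset_ball hR₀1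
  have hann : volume (ball (0 : EuclideanSpace ℝ (Fin 3)) 1 \ ball (0 : EuclideanSpace ℝ (Fin 3)) R₀) ≤
      ENNReal.ofReal (δ / 2) := by
    rw [measure_sdiff hsub measurableSet_ball.nullMeasurableSet (by rw [hballR₀]; exact ENNReal.ofReal_ne_top), hv, hballR₀,
      ← ENNReal.ofReal_sub _ (by positivity)]
    refine ENNReal.ofReal_le_ofReal ?_
    have h3 : 1 - R₀ ^ 3 ≤ 3 * (1 - R₀) := by
      have e : 1 - R₀ ^ 3 = (1 - R₀) * (1 + R₀ + R₀ ^ 2) := by ring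
      have h4 : 1 + R₀ + R₀ ^ 2 ≤ 3 := by nlinarith [hR₀0, hR₀1]
      rw [e]
      nlinarith [mul_le_mul_of_nonneg_left h4 (sub_nonneg.2 hR₀1)]
    have h5 : v - R₀ ^ 3 * v = v * (1 - R₀ ^ 3) := by ring
    rw [h5]
    nlinarith [mul_le_mul_of_nonneg_left h3 hv0.le, hR₀δ]
  have hsplit : {x : EuclideanSpace ℝ (Fin 3) | x ∈ ball (0 : EuclideanSpace ℝ (Fin 3)) 1 ∧ P x} ⊆
      {x : EuclideanSpace ℝ (Fin 3) | x ∈ ball (0 : EuclideanSpace ℝ (Fin 3)) R₀ ∧ P x} ∪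
        (ball (0 : EuclideanSpace ℝ (Fin 3)) 1 \ ball (0 : EuclideanSpace ℝ (Fin 3)) R₀) := by
    intro x hx
    by_cases hxR : x ∈ ball (0 : EuclideanSpace ℝ (Fin 3)) R₀
    · exact Or.inl ⟨hxR, hx.2⟩
    · exact Or.inr ⟨hx.1, hxR⟩
  have hkey : ENNReal.ofReal (δ / 2) + ENNReal.ofReal (δ / 2) ≤
      volume {x : EuclideanSpace ℝ (Fin 3) | x ∈ ball (0 : EuclideanSpace ℝ (Fin 3)) R₀ ∧ P x} + ENNReal.ofReal (δ / 2) := by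
    have hδ2 : 0 ≤ δ / 2 := by nlinarith [hv0, hδ₀0, hδ₀]
    calc ENNReal.ofReal (δ / 2) + ENNReal.ofReal (δ / 2) = ENNReal.ofReal δ := by
          rw [← ENNReal.ofReal_add hδ2 hδ2]; ring_nf
      _ ≤ volume {x : EuclideanSpace ℝ (Fin 3) | x ∈ ball (0 : EuclideanSpace ℝ (Fin 3)) 1 ∧ P x} := hmass
      _ ≤ volume {x : EuclideanSpace ℝ (Fin 3) | x ∈ ball (0 : EuclideanSpace ℝ (Fin 3)) R₀ ∧ P x} +
            volume (ball (0 : EuclideanSpace ℝ (Fin 3)) 1 \ ball (0 : EuclideanSpace ℝ (Fin 3)) R₀) :=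
          (measure_mono hsplit).trans (measure_union_le _ _)
      _ ≤ _ := add_le_add le_rfl hann
  have hhalf : ENNReal.ofReal (δ / 2) ≤
      volume {x : EuclideanSpace ℝ (Fin 3) | x ∈ ball (0 : EuclideanSpace ℝ (Fin 3)) R₀ ∧ P x} :=
    (ENNReal.add_le_add_iff_right ENNReal.ofReal_ne_top).1 hkey
  refine le_trans ?_ hhalf
  rw [hballR₀, ← ENNReal.ofReal_mul hδ₀0]
  refine ENNReal.ofReal_le_ofReal ?_
  have hR3 : R₀ ^ 3 ≤ 1 := pow_le_one₀ hR₀0.le hR₀1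
  calc δ₀ * (R₀ ^ 3 * v) = δ₀ * v * R₀ ^ 3 := by ring
    _ ≤ δ₀ * v * 1 := mul_le_mul_of_nonneg_left hR3 (mul_nonneg hδ₀0 hv0.le)
    _ ≤ δ / 2 := by linarith

end Summit.NavierStokesRegularity.NavierStokesRegularity.Theorems.AveragedConeLiouville.NUPositivity

end
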